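import Summits.BirchSwinnertonDyer.BirchSwinnertonDyer.Theorems.EisensteinPrimesHidaLimitFittingBound
import Literature.NumberTheory.EllipticCurves.SkinnerUrban2014.CharacteristicIdealBaseChangeNormalProofs
import HarnessLib

/-!
# The finite-submodule bound FORCES torsion: `(p)^a · char(X) ⊆ Fitt₀(X)` ⟹ `X` is `Λ`-torsion —
# so the `∃ a` conjunct of road H's `X2.HidaLimitInputsIntAt` is EQUIVALENT to "`X_ac^∅` is `Λ`-torsion"
# (crux 4 `BSDpOnCellC`, stmt-BirchSwinnertonDyer-19034, line b1 stub `stub_c3`; cell `bsd-eis`, seat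
# `bsd-eis-c3h` g0; companion of `Theorems/EisensteinPrimesHidaLimitFittingBound.lean` p458031)

HONEST FRAMING (cell `bsd-eis`): THEOREMS ONLY (pure commutative algebra); nothing booked; no label or count
moves. `Theorems/EisensteinPrimesHidaLimitFittingBound.lean` proved Keller–Yin Lemma 5.1.2: for `X` f.g.
TORSION over `Λ = ℤ_p⟦T⟧` with `char(X) = (F)`, `∃ a, (p)^a·(F) ⊆ Fitt₀(X)`. This file proves the converse
direction `exists_span_C_pow_mul_span_le_fittingIdeal_zero` ⟸: if `(p)^a·(F) ⊆ Fitt₀(X)` with `char(X) = (F)`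
then `X` is torsion — because for a NON-torsion `X` every height-one localisation `X_𝔭` contains a copy of
the discrete valuation ring `Λ_𝔭`, so every local length is infinite, every exponent of
`char = ∏ 𝔭^{length}` is the junk value `0`, `char(X) = Λ`, `F` is a unit, and `p^a ∈ Fitt₀(X) ⊆ Ann(X)`.
Hence the `∃ a` conjunct of `X2.HidaLimitInputsIntAt` (p431128) is EQUIVALENT to the `Λ`-torsion of
`X_ac^∅` — the formulation used by `Theorems/EisensteinPrimesBSDpOnCellCStubC3RoadHTorsion.lean`.

References: Washington, GTM 83, §13.2; Bourbaki AC VII §4.4 (characteristic ideal); Skinner–Urban, Invent.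
Math. 195 (2014) §3.1.6 (height-one localisations are DVRs); Eisenbud GTM 150 §20.2 (`Fitt₀ ⊆ Ann`).
-/

set_option autoImplicit false
set_option linter.dupNamespace false

noncomputable section

open scoped Classical

open Literature.RingTheory.FittingIdeal PowerSeries
  Literature.NumberTheory.EllipticCurves Literature.NumberTheory.EllipticCurves.IwasawaAlgebra

namespace Summit.BirchSwinnertonDyer.BirchSwinnertonDyer.Theorems

section NonTorsion

universe u v

variable {R : Type u} [CommRing R] [IsDomain R] {M : Type v} [AddCommGroup M] [Module R M]

/-- Localising a NON-torsion module over a domain at a submonoid not containing `0` gives a non-torsion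
module: the image `x/1` of a torsion-free element `x` has no non-zero annihilator. [folklore] -/
theorem not_isTorsion_localizedModule (S : Submonoid R) (hS : (0 : R) ∉ S)
    [Nontrivial (Localization S)] (h : ¬ Module.IsTorsion R M) :
    ¬ Module.IsTorsion (Localization S) (LocalizedModule S M) := by
  simp only [Module.IsTorsion, not_forall, not_exists] at h ⊢
  obtain ⟨x, hx⟩ := h
  refine ⟨LocalizedModule.mk x 1, fun b hb => ?_⟩
  rw [Submonoid.smul_def] at hb
  have hb0 : (b : Localization S) ≠ 0 := nonZeroDivisors.coe_ne_zero b
  revert hb hb0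
  induction (b : Localization S) using Localization.induction_on with
  | H y =>
    obtain ⟨r, s⟩ := y
    intro hb hb0
    have hr : r ≠ 0 := by
      rintro rfl
      exact hb0 (Localization.mk_zero s)
    rw [LocalizedModule.mk_smul_mk, mul_one, ← LocalizedModule.zero_mk s, LocalizedModule.mk_eq] at hb
    obtain ⟨u, hu⟩ := hb
    rw [smul_zero, smul_zero, Submonoid.smul_def, Submonoid.smul_def, smul_smul, smul_smul] at hu
    have hne : ((u : R) * (s : R) * r) ≠ 0 := by
      refine mul_ne_zero (mul_ne_zero ?_ ?_) hr
      · exact fun h0 => hS (h0 ▸ u.2)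
      · exact fun h0 => hS (h0 ▸ s.2)
    exact hx ⟨_, mem_nonZeroDivisors_of_ne_zero hne⟩ (by rw [Submonoid.smul_def]; exact hu)

end NonTorsion

section Iwasawa

variable {p : ℕ} [Fact p.Prime]

/-- **A finitely generated NON-torsion `Λ`-module has characteristic ideal `Λ`** (the tree's junk-value
convention: at every height-one `𝔭` the localisation `Λ_𝔭` is a discrete valuation ring
(`SkinnerUrban2014.isDiscreteValuationRing_localization_of_height_eq_one`) and `X_𝔭` is not torsion, so
`length(X_𝔭) = ⊤` (`Module.length_eq_top_of_not_isTorsion`) and the exponent `(⊤).toNat = 0`).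
[cite: SkinnerUrban2014, §3.1.6 (p. 19)] [cite: Washington1997, §13.2] -/
theorem charIdeal_eq_top_of_not_isTorsion (X : Type*) [AddCommGroup X] [Module (IwasawaAlgebra p) X]
    (hX : ¬ Module.IsTorsion (IwasawaAlgebra p) X) :
    Module.charIdeal (IwasawaAlgebra p) X = ⊤ := by
  unfold Module.charIdeal
  rw [← Ideal.one_eq_top]
  refine finprod_mem_of_eqOn_one fun 𝔭 h𝔭 => ?_
  haveI : 𝔭.asIdeal.IsPrime := 𝔭.isPrime
  haveI : IsDiscreteValuationRing (Localization.AtPrime 𝔭.asIdeal) :=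
    SkinnerUrban2014.isDiscreteValuationRing_localization_of_height_eq_one 𝔭.asIdeal h𝔭
  have h0 : (0 : IwasawaAlgebra p) ∉ 𝔭.asIdeal.primeCompl := fun h => h 𝔭.asIdeal.zero_mem
  have htop : Module.lengthAt (IwasawaAlgebra p) X 𝔭 = ⊤ := by
    rw [Module.lengthAt]
    exact Module.length_eq_top_of_not_isTorsion
      (not_isTorsion_localizedModule 𝔭.asIdeal.primeCompl h0 hX)
  simp [htop]

/-- **The finite-submodule bound forces torsion.** If `char_Λ(X) = (F)` and `(p)^a·(F) ⊆ Fitt₀(X)` then `X`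
is `Λ`-torsion: otherwise `char(X) = Λ` (`charIdeal_eq_top_of_not_isTorsion`), `F` is a unit, and
`p^a ∈ Fitt₀(X) ⊆ Ann(X)` (`Module.fittingIdeal_zero_le_annihilator`) kills `X` by the non-zero-divisor
`p^a`. With `exists_span_C_pow_mul_span_le_fittingIdeal_zero` (p458031): for finitely generated `X`, the
`∃ a` conjunct of `X2.HidaLimitInputsIntAt` is EQUIVALENT to the `Λ`-torsion of `X_ac^∅`. [folklore]
[cite: Eisenbud1995, §20.2 (`Fitt₀ ⊆ Ann`)] -/
theorem isTorsion_of_span_C_pow_mul_span_le_fittingIdeal_zero (X : Type*) [AddCommGroup X]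
    [Module (IwasawaAlgebra p) X] {F : IwasawaAlgebra p} {a : ℕ}
    (hF : Module.charIdeal (IwasawaAlgebra p) X = Ideal.span {F})
    (ha : Ideal.span {(C (p : ℤ_[p]) : IwasawaAlgebra p)} ^ a * Ideal.span {F} ≤
      Module.fittingIdeal (IwasawaAlgebra p) X 0) :
    Module.IsTorsion (IwasawaAlgebra p) X := by
  by_contra hX
  have htop : Ideal.span {F} = ⊤ := hF ▸ charIdeal_eq_top_of_not_isTorsion (p := p) X hX
  rw [htop, Ideal.mul_top, Ideal.span_singleton_pow, Ideal.span_singleton_le_iff_mem] at ha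
  have hann := Module.fittingIdeal_zero_le_annihilator ha
  have hne : (C (p : ℤ_[p]) : IwasawaAlgebra p) ^ a ≠ 0 :=
    pow_ne_zero _ (by
      rw [Ne, PowerSeries.ext_iff, not_forall]
      exact ⟨0, by simpa using (Fact.out : p.Prime).ne_zero⟩)
  exact hX fun x => ⟨⟨_, mem_nonZeroDivisors_of_ne_zero hne⟩, by
    rw [Submonoid.smul_def]; exact Module.mem_annihilator.mp hann x⟩

/-- **EQUIVALENCE (finitely generated `X`)**: `X` is `Λ`-torsion ↔ for every generator `F` of `char(X)`
there is `a` with `(p)^a·(F) ⊆ Fitt₀(X)` — the two directions are p458031's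
`exists_span_C_pow_mul_span_le_fittingIdeal_zero` and `isTorsion_of_span_C_pow_mul_span_le_fittingIdeal_zero`
(a generator exists by `charIdeal_isPrincipal_holds`). [folklore] -/
theorem isTorsion_iff_forall_exists_span_C_pow_mul_span_le_fittingIdeal_zero (X : Type*)
    [AddCommGroup X] [Module (IwasawaAlgebra p) X] [Module.Finite (IwasawaAlgebra p) X] :
    Module.IsTorsion (IwasawaAlgebra p) X ↔
      ∀ F : IwasawaAlgebra p, Module.charIdeal (IwasawaAlgebra p) X = Ideal.span {F} →
        ∃ a : ℕ, Ideal.span {(C (p : ℤ_[p]) : IwasawaAlgebra p)} ^ a * Ideal.span {F} ≤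
          Module.fittingIdeal (IwasawaAlgebra p) X 0 := by
  constructor
  · intro hX F hF
    exact exists_span_C_pow_mul_span_le_fittingIdeal_zero (p := p) X hX hF
  · intro h
    obtain ⟨F, hF⟩ := (charIdeal_isPrincipal_holds p X).principal
    obtain ⟨a, ha⟩ := h F hF
    exact isTorsion_of_span_C_pow_mul_span_le_fittingIdeal_zero (p := p) X hF ha

end Iwasawa

end Summit.BirchSwinnertonDyer.BirchSwinnertonDyer.Theorems

end
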